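import Literature.Topology.FourManifolds.DehnSurgeryFramingUniqueness
import Literature.Topology.FourManifolds.KnotComplementHomology
import Literature.Topology.FourManifolds.SliceRibbon
import Literature.Topology.FourManifolds.ZeroSurgeryHomotopyBallSliceGluing
import Literature.AlgebraicTopology.SingularHomology.ContractiblePunctured
import Literature.AlgebraicTopology.SingularHomology.HurewiczProofs
import Literature.AlgebraicTopology.SingularHomology.ProductWithContractible
import Literature.Topology.Euclidean.InvarianceOfDomain
import Mathlib.Topology.Maps.Proper.CompactlyGenerated
import HarnessLib

/-!
# The meridian and the longitude of a topologically flat slice disc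

Topic `Literature/Topology/FourManifolds`; a sibling of `FlatDiscExteriorHomology.lean`, written for
the topological half of the Fox–Milnor programme (the named fact
`Literature.Topology.FourManifolds.exists_eq_mul_invert_of_isTopologicallySlice`, `SliceKnots.lean`).
A topologically slice knot `K` (`Knot.IsTopologicallySlice`, `SliceRibbon.lean`) comes with a
*merely continuous* product neighbourhood `F : 𝔻² × ℝ² ↪ B⁴` of a flat slice disc, whose boundary
tube `F|S¹ × ℝ² ⊆ S³` is a topological (not smooth) tube around `K`.  Every route to the
metabolizer of the Seifert form of `K` (Livingston 2005, §2 Thm. 2.6 and §6; Kauffman 1987,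
Thm. 8.2) uses two facts about this tube which, for *smooth* tubes, are in the tree
(`DehnSurgeryFramingProofs.lean`, `DehnSurgeryFramingUniqueness.lean`, `SeifertCircleMap.lean`):

* the **meridian** `t ↦ F (x₀, r e^{2πit})` generates `H₁(S³ ∖ K; ℤ) ≅ ℤ` (so that the angular
  coordinate of `F` near the disc and the Seifert circle map of `K` have the same periods), and
* the **longitude** `t ↦ F (e^{2πit}, w)`, `w ≠ 0`, is null-homologous in `S³ ∖ K`: *the product
  framing of a flat slice disc is the zero (Seifert) framing* (Livingston 2005, proof of Thm. 2.6:
  "this depends on the triviality of the normal bundle"; §6 for the locally flat category).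

Both are proved here without any taming of the topological tube, through one four-dimensional
picture: the **radial extension** `radialExt F : ℝ² × ℝ² → ℝ⁴` (`(x, w) ↦ ‖x‖ · F(x/‖x‖, w)` for
`‖x‖ ≥ 1`) is a continuous injection, hence an open embedding (invariance of domain,
`Literature.Topology.Euclidean.Brouwer.isOpenEmbedding_of_injective`); its core
`P = radialExt F (ℝ² × {0})` is a closed flat plane of `ℝ⁴` (the slice disc completed by the cone
over `K` outside the ball) containing `S³ ∩ P = K`, so that `S³ ∖ K ⊆ ℝ⁴ ∖ P`.

* `TopFlatDisc.isIso_singularHomology_map_inter` — Mayer–Vietoris for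
  `ℝ⁴ = (ℝ⁴ ∖ P) ∪ radialExt F (ℝ² × ℝ²)` (both `ℝ⁴` and the neighbourhood contractible; Hatcher
  2002, §2.2 p. 149, in the tree as `mayerVietoris.isIso_map_inter_left_of_isZero`): the punctured
  neighbourhood `≅ ℝ² × (ℂ ∖ 0)` (`TopFlatDisc.puncturedHomeomorph`) carries `Hₖ(ℝ⁴ ∖ P)`, `k ≥ 1`;
* `TopFlatDisc.singularHomologyIsoSphereOne`, `isZero_singularHomology_planeCompl`,
  `nonempty_singularHomology_planeCompl_one_iso` — `Hₖ(ℝ⁴ ∖ P; M) ≅ Hₖ(S¹; M)` for `k ≥ 1`;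
* `TopFlatDisc.exists_eq_zsmul_loopClass_planeMeridian`,
  `TopFlatDisc.zsmul_loopClass_planeMeridian_injective` — `H₁(ℝ⁴ ∖ P; ℤ) = ℤ · h(meridian)`
  (Hurewicz, Hatcher Thm. 2A.1, `HurewiczProofs.lean`; `π₁(ℂ ∖ 0)`, `PuncturedPlane.lean`; the winding
  functional, `HurewiczOne.lean`);
* `TopFlatDisc.map_complToPlaneCompl_injective` — `H₁(S³ ∖ K; ℤ) → H₁(ℝ⁴ ∖ P; ℤ)` is injective
  (`H₁(S³ ∖ K) ≅ ℤ`, `KnotComplementHomology.lean`, and the knot meridian maps to the plane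
  meridian, of infinite order);
* `TopFlatDisc.exists_eq_zsmul_loopClass_meridian`, `zsmul_loopClass_meridian_injective`,
  `abelianization_mem_zpowers_meridian`, `zpow_abelianization_meridian_injective` — **the meridian
  of the flat tube generates `H₁(S³ ∖ K; ℤ)` and `π₁(S³ ∖ K)ᵃᵇ` and has infinite order**;
* `TopFlatDisc.loopClass_longitude`, `abelianization_of_longitude` — **the longitude of the flat
  tube is null-homologous** (it bounds the parallel disc `z ↦ radialExt F (z, w)` in `ℝ⁴ ∖ P`) and
  lies in the commutator subgroup of the knot group;
* `TopFlatDisc.winding_longitude`, `windingHomAb_bijective`, `ker_windingHom_eq_commutator`,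
  `exists_mulEquiv_inv_windingHom` — the **winding hypotheses** of the covering-space road
  (`KnotWindingHypotheses.lean`, there for smooth tubes) for the flat tube: every circle-valued map
  winds `0` times along the longitude, and if the meridian winds `±1` times along
  `f : S³ ∖ K → S¹` then `f_* : π₁(S³ ∖ K)ᵃᵇ → ℤ` is bijective, `ker f_* = [π₁, π₁]`, and
  `[g] ↦ (f_* g)⁻¹` is an isomorphism `π₁ᵃᵇ ≃* ℤ`;
* `Knot.IsTopologicallySlice.exists_meridian_longitude` — summary from `K.IsTopologicallySlice`.

Everything is proved; no named fact is introduced; the definitions are the radial extension, the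
plane, the tube maps and the meridian / longitude loops.

## References

* C. Livingston, *A survey of classical knot concordance*, Handbook of Knot Theory (2005), §2
  Thm. 2.6 and §6. [Livingston2005]
* D. Rolfsen, *Knots and Links*, Publish or Perish (1976), §3.B, §5.D (meridian, longitude,
  `H₁` of a knot complement). [Rolfsen1976]
* A. Hatcher, *Algebraic Topology*, CUP 2002, §2.2 p. 149 (Mayer–Vietoris), Thm. 2A.1
  (Hurewicz). [HatcherAT2002]
* M. H. Freedman, F. Quinn, *Topology of 4-manifolds* (1990), §9.3 (flat = locally flat with a
  product neighbourhood). [FreedmanQuinn1990]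
-/

noncomputable section

open Set Function Metric Filter Topology CategoryTheory Limits
open Literature.AlgebraicTopology.SingularHomology
open Literature.AlgebraicTopology.FundamentalGroup.PuncturedPlane

namespace Literature.Topology.FourManifolds

namespace TopFlatDisc

variable {F : EuclideanSpace ℝ (Fin 2) × EuclideanSpace ℝ (Fin 2) → EuclideanSpace ℝ (Fin 4)}

/-! ### The radial extension of a product neighbourhood -/

/-- **The radial extension** of a product neighbourhood `F : 𝔻² × ℝ² → B⁴` of a flat disc (as in
`Knot.IsTopologicallySlice`: `F(S¹ × ℝ²) ⊆ S³`) to all of `ℝ² × ℝ²`: on `‖x‖ ≥ 1` it is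
`(x, w) ↦ ‖x‖ · F(x/‖x‖, w)`, the cone over the boundary tube `F|S¹ × ℝ²` from the origin, outside
the unit ball. Its core `x ↦ radialExt F (x, 0)` is the flat disc completed by the open collar
`{r · K(u) : r > 1}` of the knot `K = F(·, 0)|S¹` to a properly embedded flat plane of `ℝ⁴`.
[folklore] -/
def radialExt (F : EuclideanSpace ℝ (Fin 2) × EuclideanSpace ℝ (Fin 2) → EuclideanSpace ℝ (Fin 4))
    (p : EuclideanSpace ℝ (Fin 2) × EuclideanSpace ℝ (Fin 2)) : EuclideanSpace ℝ (Fin 4) :=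
  if ‖p.1‖ ≤ 1 then F p else ‖p.1‖ • F (‖p.1‖⁻¹ • p.1, p.2)

/-- Inside the closed unit disc (in the first variable) the radial extension is `F`. [folklore] -/
theorem radialExt_apply_of_norm_le {x w : EuclideanSpace ℝ (Fin 2)} (h : ‖x‖ ≤ 1) :
    radialExt F (x, w) = F (x, w) := by
  simp [radialExt, h]

/-- Outside the open unit disc the radial extension is the cone over the boundary tube. [folklore] -/
theorem radialExt_apply_of_one_le {x w : EuclideanSpace ℝ (Fin 2)} (h : 1 ≤ ‖x‖) :
    radialExt F (x, w) = ‖x‖ • F (‖x‖⁻¹ • x, w) := by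
  by_cases h' : ‖x‖ ≤ 1
  · have h1 : ‖x‖ = 1 := le_antisymm h' h
    rw [radialExt_apply_of_norm_le h', h1, inv_one, one_smul, one_smul]
  · simp [radialExt, h']

/-- The radial extension on the unit circle (in the first variable) is `F`. [folklore] -/
theorem radialExt_apply_sphere (x : Metric.sphere (0 : EuclideanSpace ℝ (Fin 2)) 1)
    (w : EuclideanSpace ℝ (Fin 2)) :
    radialExt F ((x : EuclideanSpace ℝ (Fin 2)), w) = F (x, w) :=
  radialExt_apply_of_norm_le (le_of_eq (norm_eq_of_mem_sphere x))

section Norm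

variable (hnorm : ∀ x w : EuclideanSpace ℝ (Fin 2),
  ‖x‖ ≤ 1 → ‖F (x, w)‖ ≤ 1 ∧ (‖F (x, w)‖ = 1 ↔ ‖x‖ = 1))
include hnorm

/-- Outside the open unit disc the radial extension has norm `‖x‖`. [folklore] -/
theorem norm_radialExt_of_one_le {x w : EuclideanSpace ℝ (Fin 2)} (h : 1 ≤ ‖x‖) :
    ‖radialExt F (x, w)‖ = ‖x‖ := by
  have hx : 0 < ‖x‖ := one_pos.trans_le h
  have hu : ‖‖x‖⁻¹ • x‖ = 1 := by
    rw [norm_smul, norm_inv, norm_norm, inv_mul_cancel₀ hx.ne']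
  rw [radialExt_apply_of_one_le h, norm_smul, norm_norm, (hnorm _ w hu.le).2.mpr hu, mul_one]

/-- The radial extension has norm `≤ 1` exactly over the closed unit disc. [folklore] -/
theorem norm_radialExt_le_one_iff {x w : EuclideanSpace ℝ (Fin 2)} :
    ‖radialExt F (x, w)‖ ≤ 1 ↔ ‖x‖ ≤ 1 := by
  refine ⟨fun h => ?_, fun hx => ?_⟩
  · by_contra hx
    push Not at hx
    rw [norm_radialExt_of_one_le hnorm hx.le] at h
    exact lt_irrefl _ (hx.trans_le h)
  · rw [radialExt_apply_of_norm_le hx]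
    exact (hnorm x w hx).1

/-- The radial extension has norm `1` exactly over the unit circle. [folklore] -/
theorem norm_radialExt_eq_one_iff {x w : EuclideanSpace ℝ (Fin 2)} :
    ‖radialExt F (x, w)‖ = 1 ↔ ‖x‖ = 1 := by
  by_cases hx : ‖x‖ ≤ 1
  · rw [radialExt_apply_of_norm_le hx]
    exact (hnorm x w hx).2
  · push Not at hx
    rw [norm_radialExt_of_one_le hnorm hx.le]

/-- The radial extension has norm `< 1` exactly over the open unit disc. [folklore] -/
theorem norm_radialExt_lt_one_iff {x w : EuclideanSpace ℝ (Fin 2)} :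
    ‖radialExt F (x, w)‖ < 1 ↔ ‖x‖ < 1 := by
  rw [lt_iff_le_and_ne, lt_iff_le_and_ne, norm_radialExt_le_one_iff hnorm, Ne,
    norm_radialExt_eq_one_iff hnorm]

end Norm

/-- `dim (ℝ² × ℝ²) = dim ℝ⁴`. [folklore] -/
theorem finrank_prod_two_two_eq :
    Module.finrank ℝ (EuclideanSpace ℝ (Fin 2) × EuclideanSpace ℝ (Fin 2)) =
      Module.finrank ℝ (EuclideanSpace ℝ (Fin 4)) := by
  simp [Module.finrank_prod]

section Embedding

variable (hemb : IsEmbedding ((Metric.closedBall (0 : EuclideanSpace ℝ (Fin 2)) 1 ×ˢ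
  (univ : Set (EuclideanSpace ℝ (Fin 2)))).restrict F))
include hemb

/-- A product neighbourhood is continuous on `𝔻² × ℝ²`. [folklore] -/
theorem continuousOn_of_isEmbedding :
    ContinuousOn F (Metric.closedBall (0 : EuclideanSpace ℝ (Fin 2)) 1 ×ˢ univ) :=
  continuousOn_iff_continuous_restrict.2 hemb.continuous

/-- A product neighbourhood is injective on `𝔻² × ℝ²`. [folklore] -/
theorem injOn_of_isEmbedding :
    InjOn F (Metric.closedBall (0 : EuclideanSpace ℝ (Fin 2)) 1 ×ˢ univ) := by
  intro p hp q hq hpq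
  have h := hemb.injective (a₁ := ⟨p, hp⟩) (a₂ := ⟨q, hq⟩) (by simpa using hpq)
  exact congrArg Subtype.val h

/-- **The radial extension is continuous.** [folklore] -/
theorem continuous_radialExt : Continuous (radialExt F) := by
  have hF := continuousOn_of_isEmbedding hemb
  refine continuous_if_le (continuous_norm.comp continuous_fst) continuous_const ?_ ?_ ?_
  · refine hF.mono ?_
    intro p hp
    exact ⟨mem_closedBall_zero_iff.2 hp, mem_univ _⟩
  · have h0 : ∀ p : EuclideanSpace ℝ (Fin 2) × EuclideanSpace ℝ (Fin 2),
        p ∈ {p : EuclideanSpace ℝ (Fin 2) × EuclideanSpace ℝ (Fin 2) | (1 : ℝ) ≤ ‖p.1‖} →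
          ‖p.1‖ ≠ 0 := fun p hp => (one_pos.trans_le hp).ne'
    have h1 : ContinuousOn (fun p : EuclideanSpace ℝ (Fin 2) × EuclideanSpace ℝ (Fin 2) =>
        (‖p.1‖⁻¹ • p.1, p.2)) {p | (1 : ℝ) ≤ ‖p.1‖} := by
      refine ContinuousOn.prodMk ?_ continuous_snd.continuousOn
      exact (((continuous_norm.comp continuous_fst).continuousOn.inv₀ h0).smul
        continuous_fst.continuousOn)
    refine (continuous_norm.comp continuous_fst).continuousOn.smul (hF.comp h1 ?_)
    intro p hp
    refine ⟨mem_closedBall_zero_iff.2 (le_of_eq ?_), mem_univ _⟩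
    rw [norm_smul, norm_inv, norm_norm, inv_mul_cancel₀ (h0 p hp)]
  · rintro ⟨x, w⟩ (h : ‖x‖ = 1)
    simp [h]

variable (hnorm : ∀ x w : EuclideanSpace ℝ (Fin 2),
  ‖x‖ ≤ 1 → ‖F (x, w)‖ ≤ 1 ∧ (‖F (x, w)‖ = 1 ↔ ‖x‖ = 1))
include hnorm

/-- Two points outside the open unit disc with the same image under the cone are equal.
[folklore] -/
theorem eq_of_one_lt_of_radialExt_eq {x w x' w' : EuclideanSpace ℝ (Fin 2)} (hx : 1 < ‖x‖)
    (hx' : 1 < ‖x'‖) (h : radialExt F (x, w) = radialExt F (x', w')) : (x, w) = (x', w') := by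
  have hinj := injOn_of_isEmbedding hemb
  have hn : ‖x‖ = ‖x'‖ := by
    rw [← norm_radialExt_of_one_le hnorm hx.le (w := w), h, norm_radialExt_of_one_le hnorm hx'.le]
  have hne : ‖x'‖ ≠ 0 := (one_pos.trans hx').ne'
  have h1 : ‖x'‖ • F (‖x'‖⁻¹ • x, w) = ‖x'‖ • F (‖x'‖⁻¹ • x', w') := by
    rw [← hn, ← radialExt_apply_of_one_le (F := F) hx.le, h, hn, radialExt_apply_of_one_le hx'.le]
  have h2 : F (‖x'‖⁻¹ • x, w) = F (‖x'‖⁻¹ • x', w') := smul_right_injective _ hne h1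
  have hmem : ∀ y : EuclideanSpace ℝ (Fin 2), ‖y‖ = ‖x'‖ →
      (‖x'‖⁻¹ • y, w) ∈ Metric.closedBall (0 : EuclideanSpace ℝ (Fin 2)) 1 ×ˢ
        (univ : Set (EuclideanSpace ℝ (Fin 2))) := by
    intro y hy
    refine ⟨mem_closedBall_zero_iff.2 (le_of_eq ?_), mem_univ _⟩
    rw [norm_smul, norm_inv, norm_norm, hy, inv_mul_cancel₀ hne]
  have hmem' : (‖x'‖⁻¹ • x', w') ∈ Metric.closedBall (0 : EuclideanSpace ℝ (Fin 2)) 1 ×ˢ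
      (univ : Set (EuclideanSpace ℝ (Fin 2))) := by
    refine ⟨mem_closedBall_zero_iff.2 (le_of_eq ?_), mem_univ _⟩
    rw [norm_smul, norm_inv, norm_norm, inv_mul_cancel₀ hne]
  have h3 : (‖x'‖⁻¹ • x, w) = (‖x'‖⁻¹ • x', w') := hinj (hmem x hn) hmem' h2
  obtain ⟨h4, h5⟩ := Prod.mk.inj h3
  rw [h5, smul_right_injective (EuclideanSpace ℝ (Fin 2)) (inv_ne_zero hne) h4]

/-- **The radial extension is injective.** [folklore] -/
theorem injective_radialExt : Injective (radialExt F) := by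
  have hinj := injOn_of_isEmbedding hemb
  rintro ⟨x, w⟩ ⟨x', w'⟩ h
  rcases le_or_gt ‖x‖ 1 with hx | hx <;> rcases le_or_gt ‖x'‖ 1 with hx' | hx'
  · have h' : F (x, w) = F (x', w') := by
      rw [← radialExt_apply_of_norm_le (F := F) (w := w) hx, h, radialExt_apply_of_norm_le hx']
    have hm : (x, w) ∈ Metric.closedBall (0 : EuclideanSpace ℝ (Fin 2)) 1 ×ˢ
        (univ : Set (EuclideanSpace ℝ (Fin 2))) := ⟨mem_closedBall_zero_iff.2 hx, mem_univ _⟩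
    have hm' : (x', w') ∈ Metric.closedBall (0 : EuclideanSpace ℝ (Fin 2)) 1 ×ˢ
        (univ : Set (EuclideanSpace ℝ (Fin 2))) := ⟨mem_closedBall_zero_iff.2 hx', mem_univ _⟩
    exact hinj hm hm' h'
  · exfalso
    have h1 : ‖radialExt F (x, w)‖ ≤ 1 := (norm_radialExt_le_one_iff hnorm).2 hx
    rw [h, norm_radialExt_of_one_le hnorm hx'.le] at h1
    exact lt_irrefl _ (hx'.trans_le h1)
  · exfalso
    have h1 : ‖radialExt F (x', w')‖ ≤ 1 := (norm_radialExt_le_one_iff hnorm).2 hx'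
    rw [← h, norm_radialExt_of_one_le hnorm hx.le] at h1
    exact lt_irrefl _ (hx.trans_le h1)
  · exact eq_of_one_lt_of_radialExt_eq hemb hnorm hx hx' h

/-- **The radial extension is an open embedding `ℝ² × ℝ² → ℝ⁴`** (a continuous injection between
Euclidean spaces of the same dimension: invariance of domain,
`Literature.Topology.Euclidean.Brouwer.isOpenEmbedding_of_injective`). [folklore] -/
theorem isOpenEmbedding_radialExt : IsOpenEmbedding (radialExt F) :=
  Literature.Topology.Euclidean.Brouwer.isOpenEmbedding_of_injective finrank_prod_two_two_eq
    (continuous_radialExt hemb) (injective_radialExt hemb hnorm)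

end Embedding

/-! ### The flat plane and its complement -/

/-- **The flat plane** `P = radialExt F (ℝ² × {0}) ⊆ ℝ⁴`: the flat disc `F(𝔻² × {0})` completed
by the open cone `{r · K(u) : r > 1, u ∈ S¹}` over its boundary knot. [folklore] -/
def plane (F : EuclideanSpace ℝ (Fin 2) × EuclideanSpace ℝ (Fin 2) → EuclideanSpace ℝ (Fin 4)) :
    Set (EuclideanSpace ℝ (Fin 4)) :=
  range fun x : EuclideanSpace ℝ (Fin 2) => radialExt F (x, 0)

/-- The plane lies in the image of the radial extension. [folklore] -/
theorem plane_subset_range : plane F ⊆ range (radialExt F) := by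
  rintro _ ⟨x, rfl⟩
  exact ⟨(x, 0), rfl⟩

/-- The two pieces of the Mayer–Vietoris decomposition `ℝ⁴ = (ℝ⁴ ∖ P) ∪ radialExt F (ℝ² × ℝ²)`:
the plane complement. [folklore] -/
abbrev mvU (F : EuclideanSpace ℝ (Fin 2) × EuclideanSpace ℝ (Fin 2) → EuclideanSpace ℝ (Fin 4)) :
    Set (EuclideanSpace ℝ (Fin 4)) :=
  (plane F)ᶜ

/-- The two pieces of the Mayer–Vietoris decomposition: the open product neighbourhood
`radialExt F (ℝ² × ℝ²)` of the plane. [folklore] -/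
abbrev mvV (F : EuclideanSpace ℝ (Fin 2) × EuclideanSpace ℝ (Fin 2) → EuclideanSpace ℝ (Fin 4)) :
    Set (EuclideanSpace ℝ (Fin 4)) :=
  range (radialExt F)

section PlaneComplement

variable (hemb : IsEmbedding ((Metric.closedBall (0 : EuclideanSpace ℝ (Fin 2)) 1 ×ˢ
  (univ : Set (EuclideanSpace ℝ (Fin 2)))).restrict F))
variable (hnorm : ∀ x w : EuclideanSpace ℝ (Fin 2),
  ‖x‖ ≤ 1 → ‖F (x, w)‖ ≤ 1 ∧ (‖F (x, w)‖ = 1 ↔ ‖x‖ = 1))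
include hemb hnorm

/-- A point `radialExt F (x, w)` lies on the plane iff `w = 0`. [folklore] -/
theorem radialExt_mem_plane_iff {x w : EuclideanSpace ℝ (Fin 2)} :
    radialExt F (x, w) ∈ plane F ↔ w = 0 := by
  refine ⟨?_, fun h => ⟨x, by rw [h]⟩⟩
  rintro ⟨x', h⟩
  exact (congrArg Prod.snd (injective_radialExt hemb hnorm h)).symm

/-- **The flat plane is closed in `ℝ⁴`**: its parametrisation `x ↦ radialExt F (x, 0)` is a proper
map (`‖radialExt F (x, 0)‖ = ‖x‖` for `‖x‖ ≥ 1`). [folklore] -/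
theorem isClosed_plane : IsClosed (plane F) := by
  have hc : Continuous fun x : EuclideanSpace ℝ (Fin 2) => radialExt F (x, 0) :=
    (continuous_radialExt hemb).comp (continuous_id.prodMk continuous_const)
  have ht : Tendsto (fun x : EuclideanSpace ℝ (Fin 2) => radialExt F (x, 0)) (cocompact _)
      (cocompact _) := by
    rw [← Metric.cobounded_eq_cocompact (α := EuclideanSpace ℝ (Fin 4)), ← comap_norm_atTop,
      tendsto_comap_iff]
    refine (tendsto_norm_cocompact_atTop (E := EuclideanSpace ℝ (Fin 2))).congr' ?_
    have hmem : {x : EuclideanSpace ℝ (Fin 2) | 1 ≤ ‖x‖} ∈ cocompact (EuclideanSpace ℝ (Fin 2)) := by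
      refine Filter.mem_cocompact.2 ⟨Metric.closedBall 0 1, isCompact_closedBall 0 1, ?_⟩
      intro x hx
      simp only [mem_compl_iff, mem_closedBall_zero_iff, not_le] at hx
      exact hx.le
    filter_upwards [hmem] with x hx
    exact (norm_radialExt_of_one_le hnorm hx).symm
  have hp : IsProperMap fun x : EuclideanSpace ℝ (Fin 2) => radialExt F (x, 0) :=
    isProperMap_iff_tendsto_cocompact.2 ⟨hc, ht⟩
  exact hp.isClosedMap.isClosed_range

/-- The interiors of the two Mayer–Vietoris pieces cover `ℝ⁴`. [folklore] -/
theorem interior_mvU_union_interior_mvV : interior (mvU F) ∪ interior (mvV F) = univ := by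
  rw [(isClosed_plane hemb hnorm).isOpen_compl.interior_eq,
    (isOpenEmbedding_radialExt hemb hnorm).isOpen_range.interior_eq]
  refine eq_univ_of_forall fun y => ?_
  by_cases hy : y ∈ plane F
  · exact Or.inr (plane_subset_range hy)
  · exact Or.inl hy

/-- The product neighbourhood piece `radialExt F (ℝ² × ℝ²) ≅ ℝ⁴` is contractible, hence acyclic in
positive degrees. [folklore] -/
theorem isZero_singularHomology_mvV (R : Type) [CommRing R] (M : Type) [AddCommGroup M] [Module R M]
    {k : ℕ} (hk : k ≠ 0) : IsZero (singularHomology R M (mvV F) k) := by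
  haveI : ContractibleSpace (mvV F) :=
    (isOpenEmbedding_radialExt hemb hnorm).isEmbedding.toHomeomorph.contractibleSpace_iff.mp
      inferInstance
  exact isZero_singularHomology_of_contractibleSpace R M hk

/-- **Mayer–Vietoris**: the inclusion of the punctured neighbourhood `(ℝ⁴ ∖ P) ∩ radialExt F (ℝ² × ℝ²)`
into the plane complement `ℝ⁴ ∖ P` is an isomorphism on `Hₖ` for `k ≥ 1` (`ℝ⁴` and the
neighbourhood are contractible; Hatcher 2002, §2.2 p. 149). [cite: HatcherAT2002, §2.2 p. 149] -/
theorem isIso_singularHomology_map_inter (R : Type) [CommRing R] (M : Type) [AddCommGroup M]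
    [Module R M] {k : ℕ} (hk : k ≠ 0) :
    IsIso (singularHomology.map R M
      (subsetInclusion (inter_subset_left : mvU F ∩ mvV F ⊆ mvU F)) k) :=
  mayerVietoris.isIso_map_inter_left_of_isZero R M _ _ (interior_mvU_union_interior_mvV hemb hnorm)
    k (isZero_singularHomology_of_contractibleSpace R M k.succ_ne_zero)
    (isZero_singularHomology_of_contractibleSpace R M hk) (isZero_singularHomology_mvV hemb hnorm R M hk)

end PlaneComplement

/-! ### The punctured product neighbourhood `ℝ² × (ℂ ∖ 0)` -/

/-- The identification `ℂ ≃ₜ ℝ²`, `z ↦ (re z, im z)` (`PlaneComplex.ofC` / `toC`). [folklore] -/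
def ofCHomeomorph : ℂ ≃ₜ EuclideanSpace ℝ (Fin 2) where
  toFun := PlaneComplex.ofC
  invFun := toC
  left_inv := PlaneComplex.toC_ofC
  right_inv := PlaneComplex.ofC_toC
  continuous_toFun := PlaneComplex.continuous_ofC
  continuous_invFun := PlaneComplex.continuous_toC

/-- `ofC z ≠ 0 ↔ z ≠ 0`. [folklore] -/
theorem ofC_ne_zero_iff {z : ℂ} : PlaneComplex.ofC z ≠ 0 ↔ z ≠ 0 := by
  refine ⟨fun h hz => h ?_, PlaneComplex.ofC_ne_zero⟩
  rw [hz]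
  ext i
  fin_cases i <;> simp

section PuncturedNbhd

variable (hemb : IsEmbedding ((Metric.closedBall (0 : EuclideanSpace ℝ (Fin 2)) 1 ×ˢ
  (univ : Set (EuclideanSpace ℝ (Fin 2)))).restrict F))
variable (hnorm : ∀ x w : EuclideanSpace ℝ (Fin 2),
  ‖x‖ ≤ 1 → ‖F (x, w)‖ ≤ 1 ∧ (‖F (x, w)‖ = 1 ↔ ‖x‖ = 1))

/-- The punctured product neighbourhood map `ℝ² × (ℂ ∖ 0) → ℝ⁴`, `(x, z) ↦ radialExt F (x, z)`
(plane `ℝ² ≅ ℂ`). [folklore] -/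
def puncturedMap (F : EuclideanSpace ℝ (Fin 2) × EuclideanSpace ℝ (Fin 2) → EuclideanSpace ℝ (Fin 4))
    (p : EuclideanSpace ℝ (Fin 2) × CStar) : EuclideanSpace ℝ (Fin 4) :=
  radialExt F (p.1, PlaneComplex.ofC p.2)

/-- `puncturedMap` as a composite with the radial extension. [folklore] -/
theorem puncturedMap_eq_comp :
    puncturedMap F = radialExt F ∘ Prod.map id (ofCHomeomorph ∘ Subtype.val) := rfl

include hemb hnorm

/-- The punctured product neighbourhood map is an embedding. [folklore] -/
theorem isEmbedding_puncturedMap : IsEmbedding (puncturedMap F) := by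
  rw [puncturedMap_eq_comp]
  exact (isOpenEmbedding_radialExt hemb hnorm).isEmbedding.comp
    (IsEmbedding.id.prodMap (ofCHomeomorph.isEmbedding.comp IsEmbedding.subtypeVal))

/-- The image of the punctured product neighbourhood map is `(ℝ⁴ ∖ P) ∩ radialExt F (ℝ² × ℝ²)`.
[folklore] -/
theorem range_puncturedMap : range (puncturedMap F) = mvU F ∩ mvV F := by
  ext y
  constructor
  · rintro ⟨⟨x, z⟩, rfl⟩
    refine ⟨fun hy => ?_, ⟨_, rfl⟩⟩
    exact (ofC_ne_zero_iff.2 z.2) ((radialExt_mem_plane_iff hemb hnorm).1 hy)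
  · rintro ⟨hy, ⟨⟨x, w⟩, rfl⟩⟩
    have hw : w ≠ 0 := fun h => hy ((radialExt_mem_plane_iff hemb hnorm).2 h)
    refine ⟨(x, ⟨toC w, PlaneComplex.toC_ne_zero hw⟩), ?_⟩
    simp [puncturedMap, PlaneComplex.ofC_toC]

/-- **The punctured product neighbourhood** `ℝ² × (ℂ ∖ 0) ≃ₜ (ℝ⁴ ∖ P) ∩ radialExt F (ℝ² × ℝ²)`.
[folklore] -/
def puncturedHomeomorph : EuclideanSpace ℝ (Fin 2) × CStar ≃ₜ ↥(mvU F ∩ mvV F) :=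
  (isEmbedding_puncturedMap hemb hnorm).toHomeomorph.trans
    (Homeomorph.setCongr (range_puncturedMap hemb hnorm))

/-- Underlying point of `puncturedHomeomorph`. [folklore] -/
@[simp] theorem coe_puncturedHomeomorph (p : EuclideanSpace ℝ (Fin 2) × CStar) :
    (puncturedHomeomorph hemb hnorm p : EuclideanSpace ℝ (Fin 4)) =
      radialExt F (p.1, PlaneComplex.ofC p.2) := rfl

/-- **The meridian of the flat plane** through `radialExt F (x₀, r)`: the loop
`t ↦ radialExt F (x₀, r e^{2πit})` of the plane complement `ℝ⁴ ∖ P` (for `‖x₀‖ = 1` this is the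
meridian `t ↦ F (x₀, r e^{2πit}) ⊆ S³ ∖ K` of the boundary knot). [folklore] -/
def planeMeridian (x₀ : EuclideanSpace ℝ (Fin 2)) (r : ℝ) (hr : 0 < r) :
    Path (subsetInclusion (inter_subset_left : mvU F ∩ mvV F ⊆ mvU F)
        (puncturedHomeomorph hemb hnorm (x₀, bpt r hr)))
      (subsetInclusion (inter_subset_left : mvU F ∩ mvV F ⊆ mvU F)
        (puncturedHomeomorph hemb hnorm (x₀, bpt r hr))) :=
  ((sliceWindingLoop x₀ r hr).map (puncturedHomeomorph hemb hnorm).continuous).map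
    (subsetInclusion (inter_subset_left : mvU F ∩ mvV F ⊆ mvU F)).continuous

/-- Values of the plane meridian. [folklore] -/
theorem coe_planeMeridian (x₀ : EuclideanSpace ℝ (Fin 2)) (r : ℝ) (hr : 0 < r)
    (t : unitInterval) :
    ((planeMeridian hemb hnorm x₀ r hr t : ↥(mvU F)) : EuclideanSpace ℝ (Fin 4)) =
      radialExt F (x₀, PlaneComplex.ofC (windingLoop r hr 1 t)) := rfl

/-- **`H₁(ℝ⁴ ∖ P; ℤ)` is generated by the meridian**: every class is an integer multiple of the
Hurewicz class of `planeMeridian` (Mayer–Vietoris isomorphism `isIso_singularHomology_map_inter`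
and the tree's `exists_eq_zsmul_loopClass_sliceWindingLoop`, `ZeroSurgeryHomotopyBallSliceGluing.lean`:
`H₁(S × (ℂ ∖ 0); ℤ)` is generated by the slice winding loop for `S` simply connected). [folklore] -/
theorem exists_eq_zsmul_loopClass_planeMeridian (x₀ : EuclideanSpace ℝ (Fin 2)) (r : ℝ)
    (hr : 0 < r) (c : singularHomology ℤ ℤ (mvU F) 1) :
    ∃ k : ℤ, c = k • loopClass ℤ ℤ (1 : ℤ) (planeMeridian hemb hnorm x₀ r hr) := by
  set ι := subsetInclusion (inter_subset_left : mvU F ∩ mvV F ⊆ mvU F) with hι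
  set Ψ := puncturedHomeomorph hemb hnorm with hΨ
  haveI := isIso_singularHomology_map_inter hemb hnorm ℤ ℤ (k := 1) one_ne_zero
  -- pull `c` back to the punctured neighbourhood and then to the model `ℝ² × (ℂ ∖ 0)`
  set c' : singularHomology ℤ ℤ ↥(mvU F ∩ mvV F) 1 := inv (singularHomology.map ℤ ℤ ι 1) c
    with hc'
  have hc : c = singularHomology.map ℤ ℤ ι 1 c' := by
    rw [hc', ← CategoryTheory.comp_apply, IsIso.inv_hom_id, CategoryTheory.id_apply]
  set c'' : singularHomology ℤ ℤ (EuclideanSpace ℝ (Fin 2) × CStar) 1 :=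
    (singularHomology.mapIso ℤ ℤ Ψ 1).inv c' with hc''
  have hc2 : c' = singularHomology.map ℤ ℤ (Ψ : C(_, _)) 1 c'' := by
    rw [hc'', ← singularHomology.mapIso_hom, Iso.inv_hom_id_apply]
  obtain ⟨k, hk⟩ := exists_eq_zsmul_loopClass_sliceWindingLoop (S := EuclideanSpace ℝ (Fin 2)) x₀ r hr c''
  refine ⟨k, ?_⟩
  rw [hc, hc2, hk, map_zsmul, map_zsmul, map_loopClass, map_loopClass]
  rfl

/-- The fibre coordinate `(ℝ⁴ ∖ P) ∩ radialExt F (ℝ² × ℝ²) → ℂ ∖ 0`, `radialExt F (x, z) ↦ z`.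
[folklore] -/
def fibreCoord : C(↥(mvU F ∩ mvV F), CStar) :=
  ContinuousMap.comp ⟨Prod.snd, continuous_snd⟩
    ((puncturedHomeomorph hemb hnorm).symm : C(↥(mvU F ∩ mvV F), EuclideanSpace ℝ (Fin 2) × CStar))

/-- The fibre coordinate of the meridian (in the punctured neighbourhood) is the winding loop (as
singular `1`-simplices). [folklore] -/
theorem ofPath_sliceWindingLoop_map_map_fibreCoord (x₀ : EuclideanSpace ℝ (Fin 2)) (r : ℝ)
    (hr : 0 < r) :
    SingularSimplex.ofPath (((sliceWindingLoop x₀ r hr).map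
        (puncturedHomeomorph hemb hnorm).continuous).map (fibreCoord hemb hnorm).continuous) =
      SingularSimplex.ofPath (windingLoop r hr 1) := by
  apply SingularSimplex.toContinuousMap_injective
  ext s : 1
  rw [SingularSimplex.ofPath_apply, SingularSimplex.ofPath_apply]
  change ((puncturedHomeomorph hemb hnorm).symm (puncturedHomeomorph hemb hnorm
    (x₀, windingLoop r hr 1 (StdSimplex.toUnitInterval s)))).2 =
      windingLoop r hr 1 (StdSimplex.toUnitInterval s)
  rw [Homeomorph.symm_apply_apply]

/-- **The meridian has infinite order in `H₁(ℝ⁴ ∖ P; ℤ)`**: `k ↦ k • h(planeMeridian)` is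
injective (project to the fibre `ℂ ∖ 0`, where the winding loop has infinite order:
`loopClass_windingLoop_smul_injective`). [folklore] -/
theorem zsmul_loopClass_planeMeridian_injective (x₀ : EuclideanSpace ℝ (Fin 2)) (r : ℝ)
    (hr : 0 < r) :
    Function.Injective fun k : ℤ => k • loopClass ℤ ℤ (1 : ℤ) (planeMeridian hemb hnorm x₀ r hr) := by
  suffices key : ∀ k : ℤ, k • loopClass ℤ ℤ (1 : ℤ) (planeMeridian hemb hnorm x₀ r hr) = 0 →
      k = 0 by
    intro k l hkl
    have := key (k - l) (by rw [sub_zsmul, add_neg_eq_zero]; exact hkl)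
    omega
  intro k hk
  set ι := subsetInclusion (inter_subset_left : mvU F ∩ mvV F ⊆ mvU F) with hι
  haveI := isIso_singularHomology_map_inter hemb hnorm ℤ ℤ (k := 1) one_ne_zero
  have hinj : Function.Injective (singularHomology.map ℤ ℤ ι 1) :=
    (ModuleCat.mono_iff_injective _).1 inferInstance
  -- in the punctured neighbourhood
  have h1 : k • loopClass ℤ ℤ (1 : ℤ)
      ((sliceWindingLoop x₀ r hr).map (puncturedHomeomorph hemb hnorm).continuous) = 0 := by
    apply hinj
    rw [map_zsmul, map_loopClass, map_zero]
    exact hk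
  -- in the fibre
  have h2 := congrArg (singularHomology.map ℤ ℤ (fibreCoord hemb hnorm) 1) h1
  rw [map_zsmul, map_zero, map_loopClass, loopClass_eq_of_ofPath_eq ℤ ℤ 1 _ _
    (ofPath_sliceWindingLoop_map_map_fibreCoord hemb hnorm x₀ r hr)] at h2
  exact loopClass_windingLoop_smul_injective r hr (a₁ := k) (a₂ := 0) (by simpa using h2)

/-! ### The homology of the plane complement with arbitrary coefficients -/

omit hemb hnorm in
/-- `ℂ ∖ 0 ≃ₜ ℝ² ∖ 0`. [folklore] -/
def cStarHomeomorphComplZero :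
    CStar ≃ₜ ↥(({0}ᶜ : Set (EuclideanSpace ℝ (Fin 2)))) :=
  ofCHomeomorph.subtype fun z => by
    rw [mem_compl_singleton_iff]
    exact (ofC_ne_zero_iff (z := z)).symm

/-- **`Hₖ(ℝ⁴ ∖ P) ≅ Hₖ(S¹)` for `k ≥ 1`**: the plane complement has the homology of the punctured
neighbourhood `ℝ² × (ℂ ∖ 0) ≃ ℂ ∖ 0 ≃ S¹` in positive degrees (Mayer–Vietoris,
`isIso_singularHomology_map_inter`; Hatcher 2002, §2.2 and Example 2.23). [cite: HatcherAT2002, §2.2 p. 149] -/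
def singularHomologyIsoSphereOne (R : Type) [CommRing R] (M : Type) [AddCommGroup M] [Module R M]
    {k : ℕ} (hk : k ≠ 0) :
    singularHomology R M (mvU F) k ≅
      singularHomology R M (Metric.sphere (0 : EuclideanSpace ℝ (Fin 2)) 1) k :=
  haveI := isIso_singularHomology_map_inter hemb hnorm R M hk
  haveI := isIso_singularHomology_map_sphereToComplZero R M 1 k
  (asIso (singularHomology.map R M
      (subsetInclusion (inter_subset_left : mvU F ∩ mvV F ⊆ mvU F)) k)).symm ≪≫
    (singularHomology.mapIso R M (puncturedHomeomorph hemb hnorm) k).symm ≪≫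
    singularHomology.mapIso R M (Homeomorph.prodComm (EuclideanSpace ℝ (Fin 2)) CStar) k ≪≫
    singularHomology.isoOfHomotopyEquiv R M
      (prodFstHomotopyEquiv (U := CStar) (0 : EuclideanSpace ℝ (Fin 2))) k ≪≫
    singularHomology.mapIso R M cStarHomeomorphComplZero k ≪≫
    (asIso (singularHomology.map R M (sphereToComplZero 1) k)).symm

/-- **`Hₖ(ℝ⁴ ∖ P; M) = 0` for `k ≥ 2`** (the flat plane complement is a homology circle).
[cite: HatcherAT2002, §2.2 p. 149] -/
theorem isZero_singularHomology_planeCompl (R : Type) [CommRing R] (M : Type) [AddCommGroup M]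
    [Module R M] {k : ℕ} (hk : 2 ≤ k) : IsZero (singularHomology R M (mvU F) k) :=
  (isZero_singularHomology_sphere_holds R M (n := 1) (k := k) (by omega) (by omega)).of_iso
    (singularHomologyIsoSphereOne hemb hnorm R M (by omega))

/-- **`H₁(ℝ⁴ ∖ P; M) ≅ M`** (the flat plane complement is a homology circle).
[cite: HatcherAT2002, §2.2 p. 149] -/
theorem nonempty_singularHomology_planeCompl_one_iso (R : Type) [CommRing R] (M : Type)
    [AddCommGroup M] [Module R M] :
    Nonempty (singularHomology R M (mvU F) 1 ≅ ModuleCat.of R (ULift M)) :=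
  let ⟨e⟩ := nonempty_singularHomology_sphere_iso_holds R M (n := 1) le_rfl
  ⟨singularHomologyIsoSphereOne hemb hnorm R M one_ne_zero ≪≫ e⟩

end PuncturedNbhd

/-! ### The meridian and the longitude of a topologically slice knot -/

section Knot

variable {K : Knot}
variable (hemb : IsEmbedding ((Metric.closedBall (0 : EuclideanSpace ℝ (Fin 2)) 1 ×ˢ
  (univ : Set (EuclideanSpace ℝ (Fin 2)))).restrict F))
variable (hnorm : ∀ x w : EuclideanSpace ℝ (Fin 2),
  ‖x‖ ≤ 1 → ‖F (x, w)‖ ≤ 1 ∧ (‖F (x, w)‖ = 1 ↔ ‖x‖ = 1))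
variable (hK : ∀ x : Metric.sphere (0 : EuclideanSpace ℝ (Fin 2)) 1, F (x, 0) = K x)

section TubePoints

include hnorm in
/-- Over the unit circle the product neighbourhood lies on the unit sphere `S³`. [folklore] -/
theorem norm_apply_sphere (x : Metric.sphere (0 : EuclideanSpace ℝ (Fin 2)) 1)
    (w : EuclideanSpace ℝ (Fin 2)) : ‖F (x, w)‖ = 1 :=
  (hnorm x w (le_of_eq (norm_eq_of_mem_sphere x))).2.mpr (norm_eq_of_mem_sphere x)

/-- The point `F (x, w) ∈ S³` of the boundary tube (`‖x‖ = 1`). [folklore] -/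
def tubePt (x : Metric.sphere (0 : EuclideanSpace ℝ (Fin 2)) 1) (w : EuclideanSpace ℝ (Fin 2)) :
    Metric.sphere (0 : EuclideanSpace ℝ (Fin 4)) 1 :=
  ⟨F (x, w), mem_sphere_zero_iff_norm.2 (norm_apply_sphere hnorm x w)⟩

/-- Underlying point of `tubePt`. [folklore] -/
@[simp] theorem coe_tubePt (x : Metric.sphere (0 : EuclideanSpace ℝ (Fin 2)) 1)
    (w : EuclideanSpace ℝ (Fin 2)) :
    (tubePt hnorm x w : EuclideanSpace ℝ (Fin 4)) = F (x, w) := rfl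

include hemb hK in
/-- **Off the zero section the boundary tube misses the knot**: `F (x, w) ∉ K(S¹)` for `w ≠ 0`.
[folklore] -/
theorem tubePt_notMem_range (x : Metric.sphere (0 : EuclideanSpace ℝ (Fin 2)) 1)
    {w : EuclideanSpace ℝ (Fin 2)} (hw : w ≠ 0) : tubePt hnorm x w ∉ range K := by
  rintro ⟨y, hy⟩
  have h1 : F (y, 0) = F (x, w) := by
    rw [hK y]
    exact congrArg Subtype.val hy
  have hm : ((y : EuclideanSpace ℝ (Fin 2)), (0 : EuclideanSpace ℝ (Fin 2))) ∈
      Metric.closedBall (0 : EuclideanSpace ℝ (Fin 2)) 1 ×ˢ (univ : Set (EuclideanSpace ℝ (Fin 2))) :=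
    ⟨Metric.sphere_subset_closedBall y.2, mem_univ _⟩
  have hm' : ((x : EuclideanSpace ℝ (Fin 2)), w) ∈
      Metric.closedBall (0 : EuclideanSpace ℝ (Fin 2)) 1 ×ˢ (univ : Set (EuclideanSpace ℝ (Fin 2))) :=
    ⟨Metric.sphere_subset_closedBall x.2, mem_univ _⟩
  exact hw (congrArg Prod.snd (injOn_of_isEmbedding hemb hm hm' h1)).symm

/-- The point `F (x, w)` of the knot complement `S³ ∖ K` (`‖x‖ = 1`, `w ≠ 0`). [folklore] -/
def tubePtCompl (x : Metric.sphere (0 : EuclideanSpace ℝ (Fin 2)) 1) (w : EuclideanSpace ℝ (Fin 2))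
    (hw : w ≠ 0) : K.complement :=
  ⟨tubePt hnorm x w, tubePt_notMem_range hemb hnorm hK x hw⟩

/-- Underlying point of `tubePtCompl`. [folklore] -/
@[simp] theorem coe_coe_tubePtCompl (x : Metric.sphere (0 : EuclideanSpace ℝ (Fin 2)) 1)
    (w : EuclideanSpace ℝ (Fin 2)) (hw : w ≠ 0) :
    ((tubePtCompl hemb hnorm hK x w hw : Metric.sphere (0 : EuclideanSpace ℝ (Fin 4)) 1) :
      EuclideanSpace ℝ (Fin 4)) = F (x, w) := rfl

/-- **The punctured boundary tube** `S¹ × (ℂ ∖ 0) → S³ ∖ K`, `(x, z) ↦ F (x, z)` (plane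
`ℝ² ≅ ℂ`). [folklore] -/
def tubeCompl : C(Metric.sphere (0 : EuclideanSpace ℝ (Fin 2)) 1 × CStar, K.complement) where
  toFun p := tubePtCompl hemb hnorm hK p.1 (PlaneComplex.ofC p.2) (ofC_ne_zero_iff.2 p.2.2)
  continuous_toFun := by
    refine Continuous.subtype_mk (Continuous.subtype_mk ?_ _) _
    have hc : Continuous fun p : Metric.sphere (0 : EuclideanSpace ℝ (Fin 2)) 1 × CStar =>
        (((p.1 : EuclideanSpace ℝ (Fin 2)), PlaneComplex.ofC p.2) :
          EuclideanSpace ℝ (Fin 2) × EuclideanSpace ℝ (Fin 2)) :=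
      (continuous_subtype_val.comp continuous_fst).prodMk
        (PlaneComplex.continuous_ofC.comp (continuous_subtype_val.comp continuous_snd))
    refine (continuousOn_of_isEmbedding hemb).comp_continuous hc fun p => ?_
    exact ⟨Metric.sphere_subset_closedBall p.1.2, mem_univ _⟩

/-- Underlying point of `tubeCompl`. [folklore] -/
@[simp] theorem coe_coe_tubeCompl (p : Metric.sphere (0 : EuclideanSpace ℝ (Fin 2)) 1 × CStar) :
    ((tubeCompl hemb hnorm hK p : Metric.sphere (0 : EuclideanSpace ℝ (Fin 4)) 1) :
      EuclideanSpace ℝ (Fin 4)) = F (p.1, PlaneComplex.ofC p.2) := rfl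

include hnorm hK in
/-- A point of the knot complement does not lie on the flat plane. [folklore] -/
theorem coe_notMem_plane (y : K.complement) :
    ((y : Metric.sphere (0 : EuclideanSpace ℝ (Fin 4)) 1) : EuclideanSpace ℝ (Fin 4)) ∉ plane F := by
  rintro ⟨x, hx⟩
  have hx' : radialExt F (x, 0) = y := hx
  have h1 : ‖x‖ = 1 := by
    rw [← norm_radialExt_eq_one_iff hnorm (w := 0), hx']
    exact norm_eq_of_mem_sphere _
  refine y.2 ⟨⟨x, mem_sphere_zero_iff_norm.2 h1⟩, Subtype.ext ?_⟩
  rw [← hK, ← hx', radialExt_apply_of_norm_le h1.le]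

/-- **The knot complement inside the plane complement**: `S³ ∖ K → ℝ⁴ ∖ P`, `y ↦ y`.
[folklore] -/
def complToPlaneCompl : C(K.complement, ↥(mvU F)) where
  toFun y := ⟨(y : Metric.sphere (0 : EuclideanSpace ℝ (Fin 4)) 1), coe_notMem_plane hnorm hK y⟩
  continuous_toFun :=
    (continuous_subtype_val.comp continuous_subtype_val).subtype_mk _

/-- Underlying point of `complToPlaneCompl`. [folklore] -/
@[simp] theorem coe_complToPlaneCompl (y : K.complement) :
    (complToPlaneCompl hnorm hK y : EuclideanSpace ℝ (Fin 4)) = y := rfl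

end TubePoints

/-- **The meridian of `K` at `K x₀` with respect to the product neighbourhood `F`**: the loop
`t ↦ F (x₀, r e^{2πit})` of `S³ ∖ K` (`r > 0`), a small loop linking the knot once near `K x₀`
(Rolfsen 1976, §3.B / §5.D for smooth tubes; here for the merely continuous tube of a flat slice
disc). [cite: Rolfsen1976, §5.D] -/
def meridian (x₀ : Metric.sphere (0 : EuclideanSpace ℝ (Fin 2)) 1) (r : ℝ) (hr : 0 < r) :
    Path (tubeCompl hemb hnorm hK (x₀, bpt r hr)) (tubeCompl hemb hnorm hK (x₀, bpt r hr)) :=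
  (sliceWindingLoop x₀ r hr).map (tubeCompl hemb hnorm hK).continuous

/-- Values of the meridian. [folklore] -/
theorem coe_coe_meridian (x₀ : Metric.sphere (0 : EuclideanSpace ℝ (Fin 2)) 1) (r : ℝ) (hr : 0 < r)
    (t : unitInterval) :
    (((meridian hemb hnorm hK x₀ r hr t : K.complement) :
        Metric.sphere (0 : EuclideanSpace ℝ (Fin 4)) 1) : EuclideanSpace ℝ (Fin 4)) =
      F (x₀, PlaneComplex.ofC (windingLoop r hr 1 t)) := rfl

/-- In the plane complement the meridian of `K` is the plane meridian (as singular
`1`-simplices). [folklore] -/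
theorem ofPath_meridian_map_complToPlaneCompl (x₀ : Metric.sphere (0 : EuclideanSpace ℝ (Fin 2)) 1)
    (r : ℝ) (hr : 0 < r) :
    SingularSimplex.ofPath ((meridian hemb hnorm hK x₀ r hr).map
        (complToPlaneCompl hnorm hK).continuous) =
      SingularSimplex.ofPath (planeMeridian hemb hnorm x₀ r hr) := by
  apply SingularSimplex.toContinuousMap_injective
  ext s : 1
  rw [SingularSimplex.ofPath_apply, SingularSimplex.ofPath_apply]
  apply Subtype.ext
  change F (↑x₀, PlaneComplex.ofC (windingLoop r hr 1 (StdSimplex.toUnitInterval s))) =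
    radialExt F (↑x₀, PlaneComplex.ofC (windingLoop r hr 1 (StdSimplex.toUnitInterval s)))
  rw [radialExt_apply_sphere]

/-- The Hurewicz class of the meridian maps to that of the plane meridian. [folklore] -/
theorem map_loopClass_meridian (x₀ : Metric.sphere (0 : EuclideanSpace ℝ (Fin 2)) 1) (r : ℝ)
    (hr : 0 < r) :
    singularHomology.map ℤ ℤ (complToPlaneCompl hnorm hK) 1
        (loopClass ℤ ℤ (1 : ℤ) (meridian hemb hnorm hK x₀ r hr)) =
      loopClass ℤ ℤ (1 : ℤ) (planeMeridian hemb hnorm x₀ r hr) := by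
  rw [map_loopClass]
  exact loopClass_eq_of_ofPath_eq ℤ ℤ 1 _ _ (ofPath_meridian_map_complToPlaneCompl hemb hnorm hK x₀ r hr)

/-- In a `ℤ`-module isomorphic to `ℤ` any two elements are proportional, with the coefficients read
off in `ℤ`: `f(d) • c = f(c) • d`. [folklore] -/
theorem zsmul_eq_zsmul_of_linearEquiv {H : Type*} [AddCommGroup H] [Module ℤ H] (f : H ≃ₗ[ℤ] ℤ)
    (c d : H) : f d • c = f c • d := by
  apply f.injective
  rw [map_zsmul, map_zsmul]
  simp only [zsmul_eq_mul, Int.cast_id, mul_comm]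

include hemb in
/-- **The inclusion `S³ ∖ K ↪ ℝ⁴ ∖ P` is injective on `H₁(−; ℤ)`** (both groups are infinite cyclic and
the meridian of `K`, a generator up to torsion questions settled by `H₁(S³ ∖ K) ≅ ℤ`, maps to the
meridian of the plane, which has infinite order). [folklore] -/
theorem map_complToPlaneCompl_injective :
    Function.Injective (singularHomology.map ℤ ℤ (complToPlaneCompl hnorm hK) 1) := by
  set ι := complToPlaneCompl hnorm hK with hι
  obtain ⟨e⟩ := Knot.nonempty_singularHomology_complement_one_iso K ℤ ℤ
  let f : singularHomology ℤ ℤ K.complement 1 ≃ₗ[ℤ] ℤ :=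
    e.toLinearEquiv.trans ULift.moduleEquiv
  set x₀ : Metric.sphere (0 : EuclideanSpace ℝ (Fin 2)) 1 := circlePoint 0 with hx₀
  set μ := loopClass ℤ ℤ (1 : ℤ) (meridian hemb hnorm hK x₀ 1 one_pos) with hμ
  have hμι : singularHomology.map ℤ ℤ ι 1 μ =
      loopClass ℤ ℤ (1 : ℤ) (planeMeridian hemb hnorm x₀ 1 one_pos) :=
    map_loopClass_meridian hemb hnorm hK x₀ 1 one_pos
  have hinf := zsmul_loopClass_planeMeridian_injective hemb hnorm (x₀ : EuclideanSpace ℝ (Fin 2))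
    1 one_pos
  -- it suffices to show that the kernel is trivial
  suffices hker : ∀ c, singularHomology.map ℤ ℤ ι 1 c = 0 → c = 0 by
    intro c₁ c₂ h
    rw [← sub_eq_zero] at h ⊢
    exact hker _ (by rwa [map_sub])
  intro c hc
  -- `f μ • c = f c • μ`; apply `ι_*`: `f c • planeMeridian = 0`, so `f c = 0`
  have key := zsmul_eq_zsmul_of_linearEquiv f c μ
  have ha : f c • loopClass ℤ ℤ (1 : ℤ) (planeMeridian hemb hnorm x₀ 1 one_pos) =
      (0 : ℤ) • loopClass ℤ ℤ (1 : ℤ) (planeMeridian hemb hnorm x₀ 1 one_pos) := by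
    rw [zero_zsmul, ← hμι, ← map_zsmul, ← key, map_zsmul, hc, zsmul_zero]
  have ha0 : f c = 0 := hinf ha
  exact f.injective (by rw [ha0, map_zero])

/-- **`H₁(S³ ∖ K; ℤ)` is generated by the meridian of the flat product neighbourhood**: every class
is an integer multiple of the Hurewicz class of `meridian` (Rolfsen 1976, §3.B, §5.D: "`H₁` of a
knot complement is infinite cyclic, generated by a meridian" — here for the continuous tube of a
topologically flat slice disc, through the plane complement `ℝ⁴ ∖ P`). [cite: Rolfsen1976, §5.D] -/
theorem exists_eq_zsmul_loopClass_meridian (x₀ : Metric.sphere (0 : EuclideanSpace ℝ (Fin 2)) 1)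
    (r : ℝ) (hr : 0 < r) (c : singularHomology ℤ ℤ K.complement 1) :
    ∃ k : ℤ, c = k • loopClass ℤ ℤ (1 : ℤ) (meridian hemb hnorm hK x₀ r hr) := by
  obtain ⟨k, hk⟩ := exists_eq_zsmul_loopClass_planeMeridian hemb hnorm
    (x₀ : EuclideanSpace ℝ (Fin 2)) r hr (singularHomology.map ℤ ℤ (complToPlaneCompl hnorm hK) 1 c)
  refine ⟨k, map_complToPlaneCompl_injective hemb hnorm hK ?_⟩
  rw [hk, map_zsmul, map_loopClass_meridian]

/-- **The meridian has infinite order in `H₁(S³ ∖ K; ℤ)`**: `k ↦ k • h(meridian)` is injective.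
[folklore] -/
theorem zsmul_loopClass_meridian_injective (x₀ : Metric.sphere (0 : EuclideanSpace ℝ (Fin 2)) 1)
    (r : ℝ) (hr : 0 < r) :
    Function.Injective fun k : ℤ => k • loopClass ℤ ℤ (1 : ℤ) (meridian hemb hnorm hK x₀ r hr) := by
  intro k l hkl
  apply zsmul_loopClass_planeMeridian_injective hemb hnorm (x₀ : EuclideanSpace ℝ (Fin 2)) r hr
  change k • loopClass ℤ ℤ (1 : ℤ) (planeMeridian hemb hnorm x₀ r hr) =
    l • loopClass ℤ ℤ (1 : ℤ) (planeMeridian hemb hnorm x₀ r hr)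
  rw [← map_loopClass_meridian hemb hnorm hK, ← map_zsmul, ← map_zsmul]
  exact congrArg _ hkl

/-- **The abelianised knot group is generated by the meridian of the flat product neighbourhood**:
every class of `π₁(S³ ∖ K, p₀)ᵃᵇ` is a power of `[meridian]ᵃᵇ` (Hurewicz, Hatcher Thm. 2A.1, and
`exists_eq_zsmul_loopClass_meridian`). [cite: Rolfsen1976, §5.D] -/
theorem abelianization_mem_zpowers_meridian (x₀ : Metric.sphere (0 : EuclideanSpace ℝ (Fin 2)) 1)
    (r : ℝ) (hr : 0 < r)
    (g : Abelianization (FundamentalGroup K.complement (tubeCompl hemb hnorm hK (x₀, bpt r hr)))) :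
    g ∈ Subgroup.zpowers (Abelianization.of (FundamentalGroup.fromPath
      (Path.Homotopic.Quotient.mk (meridian hemb hnorm hK x₀ r hr)))) := by
  haveI : PathConnectedSpace K.complement := Knot.pathConnectedSpace_complement_holds K
  have hinj := HurewiczProof.hurewiczOneAb_injective (tubeCompl hemb hnorm hK (x₀, bpt r hr))
  obtain ⟨k, hk⟩ := exists_eq_zsmul_loopClass_meridian hemb hnorm hK x₀ r hr
    (Multiplicative.toAdd (hurewiczOneAb ℤ ℤ (1 : ℤ) _ g))
  refine Subgroup.mem_zpowers_iff.2 ⟨k, hinj ?_⟩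
  rw [map_zpow, hurewiczOneAb_of_fromPath]
  apply Multiplicative.toAdd.injective
  rw [toAdd_zpow, toAdd_ofAdd, ← hk]

/-- **The meridian has infinite order in `π₁(S³ ∖ K, p₀)ᵃᵇ`**: `k ↦ [meridian]ᵃᵇ ^ k` is
injective. [folklore] -/
theorem zpow_abelianization_meridian_injective
    (x₀ : Metric.sphere (0 : EuclideanSpace ℝ (Fin 2)) 1) (r : ℝ) (hr : 0 < r) :
    Function.Injective fun k : ℤ => (Abelianization.of (FundamentalGroup.fromPath
      (Path.Homotopic.Quotient.mk (meridian hemb hnorm hK x₀ r hr)))) ^ k :=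
  zpow_abelianization_injective_of_loopClass ℤ ℤ 1 _
    (zsmul_loopClass_meridian_injective hemb hnorm hK x₀ r hr)

/-! ### The longitude -/

/-- **The longitude (push-off) of `K` with respect to the product neighbourhood `F`**: the loop
`t ↦ F (e^{2πit}, w)` of `S³ ∖ K` (`w ≠ 0`), the boundary of the parallel flat disc
`F (𝔻² × {w})`. [cite: Rolfsen1976, §5.D] -/
def longitude (w : EuclideanSpace ℝ (Fin 2)) (hw : w ≠ 0) :
    Path (tubePtCompl hemb hnorm hK (circlePoint 0) w hw)
      (tubePtCompl hemb hnorm hK (circlePoint 0) w hw) where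
  toFun t := tubePtCompl hemb hnorm hK (circlePoint (2 * Real.pi * t)) w hw
  continuous_toFun := by
    refine Continuous.subtype_mk (Continuous.subtype_mk ?_ _) _
    have hc : Continuous fun t : unitInterval =>
        ((((circlePoint (2 * Real.pi * t) : Metric.sphere (0 : EuclideanSpace ℝ (Fin 2)) 1) :
          EuclideanSpace ℝ (Fin 2)), w) : EuclideanSpace ℝ (Fin 2) × EuclideanSpace ℝ (Fin 2)) :=
      (continuous_subtype_val.comp (continuous_circlePoint.comp (by fun_prop))).prodMk
        continuous_const
    refine (continuousOn_of_isEmbedding hemb).comp_continuous hc fun t => ?_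
    exact ⟨Metric.sphere_subset_closedBall (circlePoint _).2, mem_univ _⟩
  source' := by
    simp only [Set.Icc.coe_zero, mul_zero]
  target' := by
    simp only [Set.Icc.coe_one, mul_one]
    rw [← zero_add (2 * Real.pi), circlePoint_add_two_pi]

/-- Values of the longitude. [folklore] -/
theorem coe_coe_longitude (w : EuclideanSpace ℝ (Fin 2)) (hw : w ≠ 0) (t : unitInterval) :
    (((longitude hemb hnorm hK w hw t : K.complement) :
        Metric.sphere (0 : EuclideanSpace ℝ (Fin 4)) 1) : EuclideanSpace ℝ (Fin 4)) =
      F (circlePoint (2 * Real.pi * t), w) := rfl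

/-- The parallel flat plane `z ↦ radialExt F (z, w)` (`w ≠ 0`) inside the plane complement.
[folklore] -/
def parallelPlane (w : EuclideanSpace ℝ (Fin 2)) (hw : w ≠ 0) :
    C(EuclideanSpace ℝ (Fin 2), ↥(mvU F)) where
  toFun z := ⟨radialExt F (z, w), fun h => hw ((radialExt_mem_plane_iff hemb hnorm).1 h)⟩
  continuous_toFun :=
    ((continuous_radialExt hemb).comp (continuous_id.prodMk continuous_const)).subtype_mk _

/-- The unit circle as a loop of `ℝ²` based at `(1, 0)`. [folklore] -/
def circleLoop : Path (((circlePoint 0 : Metric.sphere (0 : EuclideanSpace ℝ (Fin 2)) 1) :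
    EuclideanSpace ℝ (Fin 2))) ((circlePoint 0 : Metric.sphere (0 : EuclideanSpace ℝ (Fin 2)) 1) :
    EuclideanSpace ℝ (Fin 2)) where
  toFun t := ((circlePoint (2 * Real.pi * t) : Metric.sphere (0 : EuclideanSpace ℝ (Fin 2)) 1) :
    EuclideanSpace ℝ (Fin 2))
  continuous_toFun := continuous_subtype_val.comp (continuous_circlePoint.comp (by fun_prop))
  source' := by
    simp only [Set.Icc.coe_zero, mul_zero]
  target' := by
    simp only [Set.Icc.coe_one, mul_one]
    rw [← zero_add (2 * Real.pi), circlePoint_add_two_pi]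

/-- In the plane complement the longitude is the boundary of the parallel plane restricted to the
unit circle (as singular `1`-simplices). [folklore] -/
theorem ofPath_longitude_map_complToPlaneCompl (w : EuclideanSpace ℝ (Fin 2)) (hw : w ≠ 0) :
    SingularSimplex.ofPath ((longitude hemb hnorm hK w hw).map
        (complToPlaneCompl hnorm hK).continuous) =
      SingularSimplex.ofPath (circleLoop.map (parallelPlane hemb hnorm w hw).continuous) := by
  apply SingularSimplex.toContinuousMap_injective
  ext s : 1
  rw [SingularSimplex.ofPath_apply, SingularSimplex.ofPath_apply]
  apply Subtype.ext
  change F (↑(circlePoint (2 * Real.pi * (StdSimplex.toUnitInterval s))), w) =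
    radialExt F (↑(circlePoint (2 * Real.pi * (StdSimplex.toUnitInterval s))), w)
  rw [radialExt_apply_sphere]

/-- **The longitude of the flat product neighbourhood is null-homologous in `S³ ∖ K`**: its
Hurewicz class in `H₁(S³ ∖ K; ℤ)` vanishes — it bounds the parallel flat disc `F (𝔻² × {w})` in
`B⁴ ∖ Δ`, so it dies in `H₁(ℝ⁴ ∖ P)`, into which `H₁(S³ ∖ K)` injects
(`map_complToPlaneCompl_injective`). Equivalently: the framing of a flat slice disc's product
neighbourhood is the Seifert (zero) framing (Livingston 2005, §2, proof of Thm. 2.6: "this depends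
on the triviality of the normal bundle"). [cite: Livingston2005, §2 Thm. 2.6] -/
theorem loopClass_longitude (w : EuclideanSpace ℝ (Fin 2)) (hw : w ≠ 0) :
    loopClass ℤ ℤ (1 : ℤ) (longitude hemb hnorm hK w hw) = 0 := by
  apply map_complToPlaneCompl_injective hemb hnorm hK
  rw [map_zero, map_loopClass, loopClass_eq_of_ofPath_eq ℤ ℤ 1 _ _
    (ofPath_longitude_map_complToPlaneCompl hemb hnorm hK w hw), ← map_loopClass,
    loopClass_eq_of_homotopic ℤ ℤ 1 (SimplyConnectedSpace.paths_homotopic circleLoop (Path.refl _)),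
    loopClass_refl, map_zero]

/-- **The longitude is trivial in the abelianised knot group**: `[longitude]ᵃᵇ = 1` in
`π₁(S³ ∖ K, q₀)ᵃᵇ`, i.e. the longitude of the flat product neighbourhood lies in the commutator
subgroup of the knot group (Hurewicz, Hatcher Thm. 2A.1, and `loopClass_longitude`).
[cite: Livingston2005, §2 Thm. 2.6] -/
theorem abelianization_of_longitude (w : EuclideanSpace ℝ (Fin 2)) (hw : w ≠ 0) :
    Abelianization.of (FundamentalGroup.fromPath
      (Path.Homotopic.Quotient.mk (longitude hemb hnorm hK w hw))) = 1 := by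
  haveI : PathConnectedSpace K.complement := Knot.pathConnectedSpace_complement_holds K
  apply HurewiczProof.hurewiczOneAb_injective (tubePtCompl hemb hnorm hK (circlePoint 0) w hw)
  rw [hurewiczOneAb_of_fromPath, loopClass_longitude, map_one, ofAdd_zero]

/-! ### Winding hypotheses for the flat tube -/

/-- **Every circle-valued map winds zero times along the longitude of the flat tube** (the winding
homomorphism `π₁ → ℤ` factors through `π₁ᵃᵇ`, where the longitude is trivial). [folklore] -/
theorem winding_longitude (f : C(K.complement, Circle)) (w : EuclideanSpace ℝ (Fin 2)) (hw : w ≠ 0) :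
    CircleMaps.winding f (longitude hemb hnorm hK w hw) = 0 := by
  have h : FundamentalGroup.fromPath (Path.Homotopic.Quotient.mk (longitude hemb hnorm hK w hw)) ∈
      commutator (FundamentalGroup K.complement (tubePtCompl hemb hnorm hK (circlePoint 0) w hw)) := by
    rw [← Abelianization.ker_of, MonoidHom.mem_ker]
    exact abelianization_of_longitude hemb hnorm hK w hw
  have h2 : CircleMaps.windingHom f _ (FundamentalGroup.fromPath
      (Path.Homotopic.Quotient.mk (longitude hemb hnorm hK w hw))) = 1 := by
    have hle : commutator (FundamentalGroup K.complement
        (tubePtCompl hemb hnorm hK (circlePoint 0) w hw)) ≤ (CircleMaps.windingHom f _).ker := by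
      rw [commutator_eq_closure, Subgroup.closure_le]
      rintro _ ⟨a, b, rfl⟩
      rw [SetLike.mem_coe, MonoidHom.mem_ker, map_commutatorElement, commutatorElement_eq_one_iff_commute]
      exact Commute.all _ _
    exact hle h
  rw [CircleMaps.windingHom_fromPath] at h2
  exact Multiplicative.ofAdd.injective h2

/-- The winding homomorphism of a circle-valued map on the abelianised knot group, based at a point
of the flat tube. [folklore] -/
def windingHomAb (f : C(K.complement, Circle)) (x₀ : Metric.sphere (0 : EuclideanSpace ℝ (Fin 2)) 1)
    (r : ℝ) (hr : 0 < r) :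
    Abelianization (FundamentalGroup K.complement (tubeCompl hemb hnorm hK (x₀, bpt r hr))) →*
      Multiplicative ℤ :=
  Abelianization.lift (CircleMaps.windingHom f _)

/-- `f̄_* [g] = f_* g`. [folklore] -/
@[simp] theorem windingHomAb_of (f : C(K.complement, Circle))
    (x₀ : Metric.sphere (0 : EuclideanSpace ℝ (Fin 2)) 1) (r : ℝ) (hr : 0 < r)
    (g : FundamentalGroup K.complement (tubeCompl hemb hnorm hK (x₀, bpt r hr))) :
    windingHomAb hemb hnorm hK f x₀ r hr (Abelianization.of g) = CircleMaps.windingHom f _ g :=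
  Abelianization.lift_apply_of _ _

/-- On the powers of the meridian `f̄_*` is `n ↦ n · (f_* μ)`. [folklore] -/
theorem windingHomAb_meridian_zpow (f : C(K.complement, Circle))
    (x₀ : Metric.sphere (0 : EuclideanSpace ℝ (Fin 2)) 1) (r : ℝ) (hr : 0 < r) (n : ℤ) :
    windingHomAb hemb hnorm hK f x₀ r hr (Abelianization.of (FundamentalGroup.fromPath
      (Path.Homotopic.Quotient.mk (meridian hemb hnorm hK x₀ r hr))) ^ n) =
      Multiplicative.ofAdd (n * CircleMaps.winding f (meridian hemb hnorm hK x₀ r hr)) := by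
  rw [map_zpow, windingHomAb_of, CircleMaps.windingHom_fromPath, ← ofAdd_zsmul, smul_eq_mul]

/-- **If the meridian of the flat tube winds `±1` times along `f`, then `f̄_* : π₁(S³ ∖ K)ᵃᵇ → ℤ`
is bijective** (the meridian generates `π₁ᵃᵇ` and has infinite order). [cite: Rolfsen1976, §7.A] -/
theorem windingHomAb_bijective (f : C(K.complement, Circle))
    (x₀ : Metric.sphere (0 : EuclideanSpace ℝ (Fin 2)) 1) (r : ℝ) (hr : 0 < r)
    (h₀ : IsUnit (CircleMaps.winding f (meridian hemb hnorm hK x₀ r hr))) :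
    Bijective (windingHomAb hemb hnorm hK f x₀ r hr) := by
  obtain ⟨u, hu⟩ := h₀
  constructor
  · rw [← MonoidHom.ker_eq_bot_iff, eq_bot_iff]
    intro a ha
    rw [MonoidHom.mem_ker] at ha
    obtain ⟨n, hn⟩ := Subgroup.mem_zpowers_iff.1
      (abelianization_mem_zpowers_meridian hemb hnorm hK x₀ r hr a)
    rw [← hn, windingHomAb_meridian_zpow] at ha
    have hn0 : n * CircleMaps.winding f (meridian hemb hnorm hK x₀ r hr) = 0 := ofAdd_eq_one.1 ha
    rw [← hu] at hn0
    have hn' : n = 0 := by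
      rcases Int.isUnit_iff.1 u.isUnit with h1 | h1 <;> rw [h1] at hn0 <;> omega
    rw [← hn, hn', zpow_zero]
    exact Subgroup.mem_bot.2 rfl
  · intro z
    refine ⟨Abelianization.of (FundamentalGroup.fromPath (Path.Homotopic.Quotient.mk
      (meridian hemb hnorm hK x₀ r hr))) ^ (Multiplicative.toAdd z * (u⁻¹ : ℤˣ)), ?_⟩
    rw [windingHomAb_meridian_zpow, ← hu, mul_assoc, Units.inv_mul, mul_one, ofAdd_toAdd]

/-- **Hypothesis `hker` for the flat tube**: if the meridian winds `±1` times along `f`, the kernel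
of the winding homomorphism is the commutator subgroup of the knot group.
[cite: Rolfsen1976, §7.A] -/
theorem ker_windingHom_eq_commutator (f : C(K.complement, Circle))
    (x₀ : Metric.sphere (0 : EuclideanSpace ℝ (Fin 2)) 1) (r : ℝ) (hr : 0 < r)
    (h₀ : IsUnit (CircleMaps.winding f (meridian hemb hnorm hK x₀ r hr))) :
    (CircleMaps.windingHom f (tubeCompl hemb hnorm hK (x₀, bpt r hr))).ker =
      commutator (FundamentalGroup K.complement (tubeCompl hemb hnorm hK (x₀, bpt r hr))) := by
  rw [← Abelianization.ker_of]
  ext g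
  rw [MonoidHom.mem_ker, MonoidHom.mem_ker, ← windingHomAb_of hemb hnorm hK f x₀ r hr g]
  constructor
  · intro h
    exact (windingHomAb_bijective hemb hnorm hK f x₀ r hr h₀).1 (h.trans (map_one _).symm)
  · intro h
    rw [h, map_one]

/-- **Hypotheses `e'`, `he'` for the flat tube**: if the meridian winds `±1` times along `f`, the
map `[g] ↦ (f_* g)⁻¹` is an isomorphism `π₁(S³ ∖ K)ᵃᵇ ≃* ℤ` (the shape consumed by
`AlexanderModuleCover.alexanderModuleEquiv` / `CutData.exists_presentation_laurent`).
[cite: Rolfsen1976, §7.A] -/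
theorem exists_mulEquiv_inv_windingHom (f : C(K.complement, Circle))
    (x₀ : Metric.sphere (0 : EuclideanSpace ℝ (Fin 2)) 1) (r : ℝ) (hr : 0 < r)
    (h₀ : IsUnit (CircleMaps.winding f (meridian hemb hnorm hK x₀ r hr))) :
    ∃ e' : Abelianization (FundamentalGroup K.complement (tubeCompl hemb hnorm hK (x₀, bpt r hr))) ≃*
        Multiplicative ℤ,
      ∀ g, e' (Abelianization.of g) = (CircleMaps.windingHom f _ g)⁻¹ :=
  ⟨(MulEquiv.ofBijective _ (windingHomAb_bijective hemb hnorm hK f x₀ r hr h₀)).trans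
    (MulEquiv.inv _), fun g => by simp⟩

end Knot

end TopFlatDisc

/-- **Meridian and longitude of a topologically slice knot** (summary from
`K.IsTopologicallySlice`): there is a flat product neighbourhood `F` of a slice disc of `K` such that,
for the meridian `t ↦ F (x₀, r e^{2πit})` and the longitude `t ↦ F (e^{2πit}, w)` (`w ≠ 0`) of its
boundary tube in `S³ ∖ K`: every class of `H₁(S³ ∖ K; ℤ)` is an integer multiple of the class of
the meridian, the meridian has infinite order, and the longitude is null-homologous (the product
framing of a flat slice disc is the zero framing; Livingston 2005, §2 Thm. 2.6 and §6).
[cite: Livingston2005, §2 Thm. 2.6] -/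
theorem Knot.IsTopologicallySlice.exists_meridian_longitude {K : Knot} (hK : K.IsTopologicallySlice) :
    ∃ (F : EuclideanSpace ℝ (Fin 2) × EuclideanSpace ℝ (Fin 2) → EuclideanSpace ℝ (Fin 4))
      (hemb : IsEmbedding ((Metric.closedBall (0 : EuclideanSpace ℝ (Fin 2)) 1 ×ˢ
        (univ : Set (EuclideanSpace ℝ (Fin 2)))).restrict F))
      (hnorm : ∀ x w : EuclideanSpace ℝ (Fin 2),
        ‖x‖ ≤ 1 → ‖F (x, w)‖ ≤ 1 ∧ (‖F (x, w)‖ = 1 ↔ ‖x‖ = 1))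
      (hKF : ∀ x : Metric.sphere (0 : EuclideanSpace ℝ (Fin 2)) 1, F (x, 0) = K x),
      (∀ (x₀ : Metric.sphere (0 : EuclideanSpace ℝ (Fin 2)) 1) (r : ℝ) (hr : 0 < r)
          (c : singularHomology ℤ ℤ K.complement 1),
          ∃ k : ℤ, c = k • loopClass ℤ ℤ (1 : ℤ) (TopFlatDisc.meridian hemb hnorm hKF x₀ r hr)) ∧
      (∀ (x₀ : Metric.sphere (0 : EuclideanSpace ℝ (Fin 2)) 1) (r : ℝ) (hr : 0 < r),
          Function.Injective fun k : ℤ =>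
            k • loopClass ℤ ℤ (1 : ℤ) (TopFlatDisc.meridian hemb hnorm hKF x₀ r hr)) ∧
      ∀ (w : EuclideanSpace ℝ (Fin 2)) (hw : w ≠ 0),
        loopClass ℤ ℤ (1 : ℤ) (TopFlatDisc.longitude hemb hnorm hKF w hw) = 0 := by
  obtain ⟨F, hemb, hnorm, hKF⟩ := hK
  exact ⟨F, hemb, hnorm, hKF,
    fun x₀ r hr c => TopFlatDisc.exists_eq_zsmul_loopClass_meridian hemb hnorm hKF x₀ r hr c,
    fun x₀ r hr => TopFlatDisc.zsmul_loopClass_meridian_injective hemb hnorm hKF x₀ r hr,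
    fun w hw => TopFlatDisc.loopClass_longitude hemb hnorm hKF w hw⟩

end Literature.Topology.FourManifolds
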